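import Literature.Analysis.FluidPDE.MillerMiddleEigenvalueGronwall
import HarnessLib

/-!
# Miller's enstrophy production bound with an `L^∞` majorant of the middle principal strain
# (Neustupa–Penel 2001 / Miller 2019, the endpoint `q = ∞`)

Analysis/FluidPDE proofs file (theorems only).  The tree's
`integral_sum_inner_fderiv_le_of_momentum_of_midStrain` (`MillerMiddleEigenvalueGronwall.lean`) bounds the
enstrophy production `∫ Σᵢ ⟪∂ᵢv, ∂ᵢW⟫` of a slice of the Navier–Stokes system by `C ν^{1−1/θ} ‖m‖_{L^r}^{1/θ} ∫|∇v|²`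
for an `L^r` majorant `m` of the middle principal strain `λ₂(∇v)`, `3/2 < r < ∞` (Miller 2019 Thm 1.1 / Neustupa–Penel
2001 Thm 2, via interpolation and Young).  This file records the ENDPOINT `r = ∞` (no interpolation): if
`λ₂(∇v(x)) ≤ M₀` at every `x` (two-frame Courant–Fischer form), then

* `integral_sum_inner_fderiv_le_of_momentum_of_midStrain_le` —
  `∫ Σᵢ ⟪∂ᵢv, ∂ᵢW⟫ ≤ −ν ∫‖Δv‖² + 2 M₀ ∫ |∇v|²_F`

(the same Steps 1–5 as the tree's proof: `∫ Σᵢ⟪∂ᵢv, ∂ᵢW⟫ = −ν‖Δv‖² + ∫⟪Δv, (v·∇)v⟫`, pressure term `0`,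
`∫⟪Δv,(v·∇)v⟫ ≤ ∫ (2 λ₂⁺|∇v|²_F + det ∇v)` pointwise (Miller's Lemma 5.1) with `∫ det ∇v = 0`, then `λ₂⁺ ≤ M₀`).
This is the slice inequality behind the `L^∞_x` member `‖λ₂⁺(t)‖_∞` of the Neustupa–Penel / Miller family, i.e. the
Grönwall density for conditions of the type `λ₂⁺(t,x) ≤ ε/(T−t)` (the cell nsreg-p1 ROUND-15 rung (ii)).

References: Miller, ARMA 235 (2020) = arXiv:1710.05569, Thm 1.1, Lemma 5.1 [Miller2019]; Neustupa–Penel 2001, Thm 2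
[NeustupaPenel2001].
-/

noncomputable section
open MeasureTheory Set Function Filter Topology InnerProductSpace
open scoped ENNReal NNReal ContDiff RealInnerProductSpace Laplacian Matrix

namespace Literature.Analysis.FluidPDE

/-- `‖∇vᵢ(y)‖ ≤ ‖Dv(y)‖` for the coordinate gradients of a differentiable field. [folklore] -/
private theorem norm_gradient_coord_le_norm_fderiv'
    {v : EuclideanSpace ℝ (Fin 3) → EuclideanSpace ℝ (Fin 3)} {y : EuclideanSpace ℝ (Fin 3)}
    (hd : DifferentiableAt ℝ v y) (i : Fin 3) :
    ‖gradient (fun z => v z i) y‖ ≤ ‖fderiv ℝ v y‖ := by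
  set w := gradient (fun z => v z i) y with hw
  have h1 : ‖w‖ ^ 2 ≤ ‖fderiv ℝ v y‖ * ‖w‖ := by
    rw [← real_inner_self_eq_norm_sq, hw, inner_gradient_coord_eq hd i]
    calc fderiv ℝ v y (gradient (fun z => v z i) y) i
        ≤ |fderiv ℝ v y (gradient (fun z => v z i) y) i| := le_abs_self _
      _ ≤ ‖fderiv ℝ v y (gradient (fun z => v z i) y)‖ := by
          simpa [Real.norm_eq_abs] using
            PiLp.norm_apply_le (fderiv ℝ v y (gradient (fun z => v z i) y)) i
      _ ≤ ‖fderiv ℝ v y‖ * ‖gradient (fun z => v z i) y‖ := (fderiv ℝ v y).le_opNorm _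
  by_cases hw0 : ‖w‖ = 0
  · rw [hw0]; exact norm_nonneg _
  · exact le_of_mul_le_mul_right (by nlinarith [h1]) (lt_of_le_of_ne (norm_nonneg _) (Ne.symm hw0))

/-- **Hadamard-type bound for the Jacobian determinant on `ℝ³`**:
`|det Dv(y)| ≤ ½ ‖Dv(y)‖ |Dv(y)|²_F` (`det Dv = ⟪∇v₀, ∇v₁ × ∇v₂⟫`,
`‖∇v₁ × ∇v₂‖ ≤ ‖∇v₁‖ ‖∇v₂‖ ≤ ½ |Dv|²_F` and `‖∇v₀‖ ≤ ‖Dv‖`). [folklore] -/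
private theorem abs_det_fderiv_le'
    {v : EuclideanSpace ℝ (Fin 3) → EuclideanSpace ℝ (Fin 3)} {y : EuclideanSpace ℝ (Fin 3)}
    (hd : DifferentiableAt ℝ v y) :
    |LinearMap.det (fderiv ℝ v y : EuclideanSpace ℝ (Fin 3) →ₗ[ℝ] EuclideanSpace ℝ (Fin 3))| ≤
      1 / 2 * ‖fderiv ℝ v y‖ * FluidPDE.frobeniusNormSq (fderiv ℝ v y) := by
  rw [det_fderiv_eq_inner_gradient_cross hd]
  set g0 := gradient (fun z => v z 0) y
  set g1 := gradient (fun z => v z 1) y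
  set g2 := gradient (fun z => v z 2) y
  have hcross : ‖cross g1 g2‖ ≤ ‖g1‖ * ‖g2‖ := by
    rw [norm_cross]
    exact mul_le_of_le_one_right (by positivity) (Real.sin_le_one _)
  have hF := frobeniusNormSq_fderiv_eq_sum_norm_gradient_sq hd
  have hgg : ‖g1‖ * ‖g2‖ ≤ (1 / 2) * FluidPDE.frobeniusNormSq (fderiv ℝ v y) := by
    rw [hF]
    nlinarith [sq_nonneg (‖g1‖ - ‖g2‖), sq_nonneg ‖g0‖]
  calc |⟪g0, cross g1 g2⟫_ℝ| ≤ ‖g0‖ * ‖cross g1 g2‖ := abs_real_inner_le_norm _ _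
    _ ≤ ‖fderiv ℝ v y‖ * (‖g1‖ * ‖g2‖) :=
        mul_le_mul (norm_gradient_coord_le_norm_fderiv' hd 0) hcross (norm_nonneg _) (norm_nonneg _)
    _ ≤ ‖fderiv ℝ v y‖ * ((1 / 2) * FluidPDE.frobeniusNormSq (fderiv ℝ v y)) :=
        mul_le_mul_of_nonneg_left hgg (norm_nonneg _)
    _ = 1 / 2 * ‖fderiv ℝ v y‖ * FluidPDE.frobeniusNormSq (fderiv ℝ v y) := by ring

/-- `|∇v|²_F` is integrable for a `C¹` field with `Dv ∈ L²`. [folklore] -/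
private theorem integrable_frobeniusNormSq_fderiv'
    {v : EuclideanSpace ℝ (Fin 3) → EuclideanSpace ℝ (Fin 3)} (hv : ContDiff ℝ 1 v)
    (hv1 : ∫⁻ x, ‖iteratedFDeriv ℝ 1 v x‖ₑ ^ 2 < ⊤) :
    Integrable (fun x => FluidPDE.frobeniusNormSq (fderiv ℝ v x)) volume := by
  have hDv_eq : ∀ x, ‖fderiv ℝ v x‖ = ‖iteratedFDeriv ℝ 1 v x‖ := fun x => by
    rw [← norm_iteratedFDeriv_fderiv, norm_iteratedFDeriv_zero]
  have l2Dv : ∫⁻ x, ‖fderiv ℝ v x‖ₑ ^ 2 < ⊤ :=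
    lintegral_enorm_sq_lt_top_of_norm_le (fun x => (hDv_eq x).le) hv1
  have lfrob : ∫⁻ x, ENNReal.ofReal (FluidPDE.frobeniusNormSq (fderiv ℝ v x)) < ⊤ :=
    calc ∫⁻ x, ENNReal.ofReal (FluidPDE.frobeniusNormSq (fderiv ℝ v x))
        ≤ ∫⁻ x, 3 * ‖fderiv ℝ v x‖ₑ ^ 2 :=
          lintegral_mono fun x => ofReal_frobeniusNormSq_le_three_mul_enorm_sq _
      _ = 3 * ∫⁻ x, ‖fderiv ℝ v x‖ₑ ^ 2 := lintegral_const_mul' _ _ (by norm_num)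
      _ < ⊤ := ENNReal.mul_lt_top (by norm_num) l2Dv
  exact integrable_of_continuous_of_nonneg (FluidPDE.continuous_frobeniusNormSq_fderiv hv (by simp))
    (fun x => FluidPDE.frobeniusNormSq_nonneg _) lfrob

/-- `det ∇v` is integrable for a `C¹` field with bounded gradient `Dv ∈ L²`
(`|det Dv| ≤ ½ B₁ |Dv|²_F`). [folklore] -/
private theorem integrable_det_fderiv'
    {v : EuclideanSpace ℝ (Fin 3) → EuclideanSpace ℝ (Fin 3)} (hv : ContDiff ℝ 1 v)
    {B₁ : ℝ} (hB₁ : ∀ x, ‖fderiv ℝ v x‖ ≤ B₁)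
    (hv1 : ∫⁻ x, ‖iteratedFDeriv ℝ 1 v x‖ₑ ^ 2 < ⊤) :
    Integrable (fun x => LinearMap.det
      (fderiv ℝ v x : EuclideanSpace ℝ (Fin 3) →ₗ[ℝ] EuclideanSpace ℝ (Fin 3))) volume := by
  have hdV : ∀ y, DifferentiableAt ℝ v y := fun y => (hv.differentiable (by simp)) y
  have hgc : Continuous fun x => LinearMap.det
      (fderiv ℝ v x : EuclideanSpace ℝ (Fin 3) →ₗ[ℝ] EuclideanSpace ℝ (Fin 3)) := by
    have : (fun x => LinearMap.det
        (fderiv ℝ v x : EuclideanSpace ℝ (Fin 3) →ₗ[ℝ] EuclideanSpace ℝ (Fin 3))) =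
        fun x => (fderiv ℝ v x).det := rfl
    rw [this]
    exact ContinuousLinearMap.continuous_det.comp (hv.continuous_fderiv (by simp))
  refine ((integrable_frobeniusNormSq_fderiv' hv hv1).const_mul (1 / 2 * B₁)).mono'
    hgc.aestronglyMeasurable (Eventually.of_forall fun y => ?_)
  rw [Real.norm_eq_abs]
  refine (abs_det_fderiv_le' (hdV y)).trans ?_
  exact mul_le_mul_of_nonneg_right (mul_le_mul_of_nonneg_left (hB₁ y) (by norm_num))
    (FluidPDE.frobeniusNormSq_nonneg _)

set_option maxHeartbeats 400000 in
/-- **The enstrophy production bound by an `L^∞` majorant of the middle principal strain** (endpoint `q = ∞` of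
Miller 2019 Thm 1.1 / Neustupa–Penel 2001 Thm 2).  Let `v : ℝ³ → ℝ³` be smooth and divergence free,
`W : ℝ³ → ℝ³` and `q : ℝ³ → ℝ` be `C¹`, with the momentum equation `W + (v·∇)v = νΔv − ∇q` (`ν > 0`), `v` and `Dv`
bounded, `Dv, D²v, D³v, W, DW, q, Dq ∈ L²`, and let `M₀ ≥ 0` majorise the middle principal strain `λ₂(Dv(x))` at
every `x` (two-frame Courant–Fischer form).  Then `∫ Σᵢ ⟪∂ᵢv, ∂ᵢW⟫ ≤ −ν ∫‖Δv‖² + 2 M₀ ∫ |∇v|²_F`.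
[cite: Miller2019, Thm 1.1 (proof of Thm 5.2), Lemma 5.1] [cite: NeustupaPenel2001, Thm 2] -/
theorem integral_sum_inner_fderiv_le_of_momentum_of_midStrain_le {ν : ℝ}
    {v W : EuclideanSpace ℝ (Fin 3) → EuclideanSpace ℝ (Fin 3)} {q : EuclideanSpace ℝ (Fin 3) → ℝ}
    (hv : ContDiff ℝ ∞ v) (hW : ContDiff ℝ 1 W) (hq : ContDiff ℝ 1 q)
    (hmom : ∀ x, W x + FluidPDE.convect v v x = ν • (Δ v) x - gradient q x)
    (hdiv : VectorCalculus.IsDivFree v) {B : ℝ} (hB : ∀ x, ‖v x‖ ≤ B)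
    {B₁ : ℝ} (hB₁ : ∀ x, ‖fderiv ℝ v x‖ ≤ B₁)
    {M₀ : ℝ} (hM₀ : 0 ≤ M₀)
    (hmaj : ∀ x, ∃ y z : EuclideanSpace ℝ (Fin 3), ‖y‖ = 1 ∧ ‖z‖ = 1 ∧ ⟪y, z⟫ = 0 ∧
      ∀ α β : ℝ, ⟪fderiv ℝ v x (α • y + β • z), α • y + β • z⟫ ≤ M₀ * (α ^ 2 + β ^ 2))
    (hv1 : ∫⁻ x, ‖iteratedFDeriv ℝ 1 v x‖ₑ ^ 2 < ⊤) (hv2 : ∫⁻ x, ‖iteratedFDeriv ℝ 2 v x‖ₑ ^ 2 < ⊤)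
    (hv3 : ∫⁻ x, ‖iteratedFDeriv ℝ 3 v x‖ₑ ^ 2 < ⊤)
    (hW0 : ∫⁻ x, ‖W x‖ₑ ^ 2 < ⊤) (hW1 : ∫⁻ x, ‖iteratedFDeriv ℝ 1 W x‖ₑ ^ 2 < ⊤)
    (hq0 : ∫⁻ x, ‖q x‖ₑ ^ 2 < ⊤) (hq1 : ∫⁻ x, ‖iteratedFDeriv ℝ 1 q x‖ₑ ^ 2 < ⊤) :
    ∫ x, ∑ i, ⟪fderiv ℝ v x (EuclideanSpace.basisFun (Fin 3) ℝ i),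
        fderiv ℝ W x (EuclideanSpace.basisFun (Fin 3) ℝ i)⟫ ≤
      -ν * (∫ x, ‖(Δ v) x‖ ^ 2) + 2 * M₀ * ∫ x, FluidPDE.frobeniusNormSq (fderiv ℝ v x) := by
  set e := EuclideanSpace.basisFun (Fin 3) ℝ with he
  have he1 : ∀ i, ‖e i‖ = 1 := fun i => by simp [he]
  set K : ℝ≥0 := SNormLESNormFDerivOfEqConst (EuclideanSpace ℝ (Fin 3))
    (volume : Measure (EuclideanSpace ℝ (Fin 3))) 2 with hK
  have hB0 : 0 ≤ B := (norm_nonneg _).trans (hB 0)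
  have hB₁0 : 0 ≤ B₁ := (norm_nonneg _).trans (hB₁ 0)
  -- smoothness and continuity
  have hv3' : ContDiff ℝ 3 v := hv.of_le (by norm_cast)
  have hv2' : ContDiff ℝ 2 v := hv.of_le (by norm_cast)
  have hv1' : ContDiff ℝ 1 v := hv.of_le (by norm_cast)
  have hdV : ∀ y, DifferentiableAt ℝ v y := fun y => (hv.differentiable (by simp)) y
  have hΔ1 : ContDiff ℝ 1 (Δ v) := contDiff_one_laplacian_of_contDiff_three hv3'
  have cv : Continuous v := hv.continuous
  have cDv : Continuous (fderiv ℝ v) := hv.continuous_fderiv (by simp)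
  have cD2 : Continuous fun x => iteratedFDeriv ℝ 2 v x := hv.continuous_iteratedFDeriv (by norm_cast)
  have cD3 : Continuous fun x => iteratedFDeriv ℝ 3 v x := hv.continuous_iteratedFDeriv (by norm_cast)
  have cdiv : ∀ i, Continuous fun x => fderiv ℝ v x (e i) := fun i => cDv.clm_apply continuous_const
  have cdvs : ∀ j i, Continuous fun x => fderiv ℝ (fun y => fderiv ℝ v y (e j)) x (e i) := fun j i =>
    ((((hv3'.fderiv_right (m := 2) (by norm_num)).clm_apply contDiff_const).continuous_fderiv
      (by norm_num)).clm_apply continuous_const)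
  have cW : Continuous W := hW.continuous
  have cDW : Continuous (fderiv ℝ W) := hW.continuous_fderiv one_ne_zero
  have cdiW : ∀ i, Continuous fun x => fderiv ℝ W x (e i) := fun i => cDW.clm_apply continuous_const
  have cq : Continuous q := hq.continuous
  have cDq : Continuous (fderiv ℝ q) := hq.continuous_fderiv one_ne_zero
  have cdiq : ∀ i, Continuous fun x => fderiv ℝ q x (e i) := fun i => cDq.clm_apply continuous_const
  have cgq : Continuous (gradient q) := by
    have : gradient q = fun x => (InnerProductSpace.toDual ℝ _).symm (fderiv ℝ q x) := rfl
    rw [this]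
    exact (InnerProductSpace.toDual ℝ (EuclideanSpace ℝ (Fin 3))).symm.continuous.comp cDq
  have cΔ : Continuous (Δ v) := hΔ1.continuous
  have cdΔ : ∀ i, Continuous fun x => fderiv ℝ (Δ v) x (e i) := fun i =>
    (hΔ1.continuous_fderiv one_ne_zero).clm_apply continuous_const
  have cconv : Continuous (FluidPDE.convect v v) := cDv.clm_apply cv
  have c3D2 : Continuous fun x => (3 : ℝ) • iteratedFDeriv ℝ 2 v x := cD2.const_smul (3 : ℝ)
  have c3D3 : Continuous fun x => (3 : ℝ) • iteratedFDeriv ℝ 3 v x := cD3.const_smul (3 : ℝ)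
  have cBDv : Continuous fun x => B • fderiv ℝ v x := cDv.const_smul B
  -- the weight `φ = λ₂⁺ ∘ Dv`: continuous, `0 ≤ φ ≤ B₁`, `φ ≤ M₀`
  set φ : EuclideanSpace ℝ (Fin 3) → ℝ := fun x =>
    max (strainEigenvalues (fderiv ℝ v x : EuclideanSpace ℝ (Fin 3) →ₗ[ℝ] EuclideanSpace ℝ (Fin 3))
      finrank_euclideanSpace_fin 1) 0 with hφdef
  have hφc : Continuous φ := (lipschitzWith_midStrain.continuous.comp cDv).max continuous_const
  have hφ0 : ∀ x, 0 ≤ φ x := fun x => le_max_right _ _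
  have hφB : ∀ x, φ x ≤ B₁ := fun x =>
    max_le ((midStrain_le_opNorm _).trans (hB₁ x)) ((norm_nonneg _).trans (hB₁ x))
  have hφm : ∀ x, φ x ≤ M₀ := by
    intro x
    refine max_le ?_ hM₀
    obtain ⟨y, z, hy, hz, hyz, h⟩ := hmaj x
    exact (strainEigenvalues_mid_le_iff
      (fderiv ℝ v x : EuclideanSpace ℝ (Fin 3) →ₗ[ℝ] EuclideanSpace ℝ (Fin 3))
      finrank_euclideanSpace_fin M₀).2 ⟨y, z, hy, hz, hyz, fun α β => by
        simpa only [ContinuousLinearMap.coe_coe] using h α β⟩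
  -- pointwise norm bounds
  have hDv_eq : ∀ x, ‖fderiv ℝ v x‖ = ‖iteratedFDeriv ℝ 1 v x‖ := fun x => by
    rw [← norm_iteratedFDeriv_fderiv, norm_iteratedFDeriv_zero]
  have n_Δ : ∀ x, ‖(Δ v) x‖ ≤ ‖(3 : ℝ) • iteratedFDeriv ℝ 2 v x‖ := fun x => by
    rw [norm_smul, Real.norm_of_nonneg (by norm_num : (0 : ℝ) ≤ 3)]
    exact norm_laplacian_le_three_mul_norm_iteratedFDeriv_two hv2' x
  have n_dΔ : ∀ i x, ‖fderiv ℝ (Δ v) x (e i)‖ ≤ ‖(3 : ℝ) • iteratedFDeriv ℝ 3 v x‖ := fun i x => by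
    rw [norm_smul, Real.norm_of_nonneg (by norm_num : (0 : ℝ) ≤ 3),
      fderiv_laplacian_apply_of_contDiff_three hv3' x (e i)]
    exact (norm_laplacian_le_three_mul_norm_iteratedFDeriv_two
      ((hv3'.fderiv_right (m := 2) (by norm_num)).clm_apply contDiff_const) x).trans
      (mul_le_mul_of_nonneg_left (norm_iteratedFDeriv_fderiv_apply_basisFun_le hv3' 2 (by norm_num) x i)
        (by norm_num))
  have n_conv : ∀ x, ‖FluidPDE.convect v v x‖ ≤ ‖B • fderiv ℝ v x‖ := fun x => by
    rw [FluidPDE.convect, norm_smul, Real.norm_of_nonneg hB0, mul_comm]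
    exact (fderiv ℝ v x).le_opNorm_of_le (hB x)
  have n_gq : ∀ x, ‖gradient q x‖ = ‖iteratedFDeriv ℝ 1 q x‖ := fun x => by
    rw [gradient, LinearIsometryEquiv.norm_map, ← norm_iteratedFDeriv_fderiv, norm_iteratedFDeriv_zero]
  have hin : ∀ i (y : EuclideanSpace ℝ (Fin 3)), ‖⟪e i, y⟫‖ ≤ ‖y‖ := fun i y =>
    (norm_inner_le_norm (𝕜 := ℝ) (e i) y).trans (by rw [he1, one_mul])
  -- finite `L²` norms
  have l2Dv : ∫⁻ x, ‖fderiv ℝ v x‖ₑ ^ 2 < ⊤ :=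
    lintegral_enorm_sq_lt_top_of_norm_le (fun x => (hDv_eq x).le) hv1
  have l2smul3 : ∀ {n : ℕ}, ∫⁻ x, ‖iteratedFDeriv ℝ n v x‖ₑ ^ 2 < ⊤ →
      ∫⁻ x, ‖(3 : ℝ) • iteratedFDeriv ℝ n v x‖ₑ ^ 2 < ⊤ := by
    intro n h
    have : ∀ x, ‖(3 : ℝ) • iteratedFDeriv ℝ n v x‖ₑ ^ 2 =
        ENNReal.ofReal (3 ^ 2) * ‖iteratedFDeriv ℝ n v x‖ₑ ^ 2 := by
      intro x
      rw [enorm_smul, mul_pow, Real.enorm_eq_ofReal (by norm_num : (0:ℝ) ≤ 3),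
        ENNReal.ofReal_pow (by norm_num : (0:ℝ) ≤ 3)]
    simp_rw [this]
    rw [lintegral_const_mul' _ _ ENNReal.ofReal_ne_top]
    exact ENNReal.mul_lt_top ENNReal.ofReal_lt_top h
  have l2Δ : ∫⁻ x, ‖(3 : ℝ) • iteratedFDeriv ℝ 2 v x‖ₑ ^ 2 < ⊤ := l2smul3 hv2
  have l2dΔ : ∫⁻ x, ‖(3 : ℝ) • iteratedFDeriv ℝ 3 v x‖ₑ ^ 2 < ⊤ := l2smul3 hv3
  have l2BDv : ∫⁻ x, ‖B • fderiv ℝ v x‖ₑ ^ 2 < ⊤ := by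
    have : ∀ x, ‖B • fderiv ℝ v x‖ₑ ^ 2 = ‖B‖ₑ ^ 2 * ‖fderiv ℝ v x‖ₑ ^ 2 := fun x => by
      rw [enorm_smul, mul_pow]
    simp_rw [this]
    rw [lintegral_const_mul' _ _ (by simp)]
    exact ENNReal.mul_lt_top (by simp) l2Dv
  have l2gq : ∫⁻ x, ‖gradient q x‖ₑ ^ 2 < ⊤ :=
    lintegral_enorm_sq_lt_top_of_norm_le (fun x => (n_gq x).le) hq1
  have l2diq : ∀ i, ∫⁻ x, ‖fderiv ℝ q x (e i)‖ₑ ^ 2 < ⊤ := fun i =>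
    lintegral_enorm_sq_lt_top_of_norm_le (fun x => norm_fderiv_apply_basisFun_le q x i) hq1
  have l2div : ∀ i, ∫⁻ x, ‖fderiv ℝ v x (e i)‖ₑ ^ 2 < ⊤ := fun i =>
    lintegral_enorm_sq_lt_top_of_norm_le (fun x => by
      simpa [he1] using (fderiv ℝ v x).le_opNorm (e i)) l2Dv
  have l2diW : ∀ i, ∫⁻ x, ‖fderiv ℝ W x (e i)‖ₑ ^ 2 < ⊤ := fun i =>
    lintegral_enorm_sq_lt_top_of_norm_le (fun x => norm_fderiv_apply_basisFun_le W x i) hW1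
  have l2ddv : ∀ i, ∫⁻ x, ‖fderiv ℝ (fun y => fderiv ℝ v y (e i)) x (e i)‖ₑ ^ 2 < ⊤ := fun i =>
    lintegral_enorm_sq_lt_top_of_norm_le (fun x => norm_fderiv_fderiv_apply_basisFun_le hv2' x i) hv2
  have l2dvs : ∀ j i, ∫⁻ x, ‖fderiv ℝ (fun y => fderiv ℝ v y (e j)) x (e i)‖ₑ ^ 2 < ⊤ := fun j i =>
    lintegral_enorm_sq_lt_top_of_norm_le (fun x =>
      (norm_fderiv_apply_basisFun_le (fun y => fderiv ℝ v y (e j)) x i).trans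
        (norm_iteratedFDeriv_fderiv_apply_basisFun_le hv3' 1 (by norm_num) x j)) hv2
  -- integrability of the products
  have i1 : ∀ i, Integrable (fun x => ⟪fderiv ℝ (fun y => fderiv ℝ v y (e i)) x (e i), W x⟫)
      volume := fun i =>
    integrable_of_norm_le_mul_of_lintegral_sq ((cdvs i i).inner cW).aestronglyMeasurable (cdvs i i) cW
      (l2ddv i) hW0 fun x => norm_inner_le_norm _ _
  have i2 : ∀ i, Integrable (fun x => ⟪fderiv ℝ v x (e i), fderiv ℝ W x (e i)⟫) volume := fun i =>
    integrable_of_norm_le_mul_of_lintegral_sq ((cdiv i).inner (cdiW i)).aestronglyMeasurable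
      (cdiv i) (cdiW i) (l2div i) (l2diW i) fun x => norm_inner_le_norm _ _
  have i3 : ∀ i, Integrable (fun x => ⟪fderiv ℝ v x (e i), W x⟫) volume := fun i =>
    integrable_of_norm_le_mul_of_lintegral_sq ((cdiv i).inner cW).aestronglyMeasurable (cdiv i) cW
      (l2div i) hW0 fun x => norm_inner_le_norm _ _
  have iΔΔ : Integrable (fun x => ‖(Δ v) x‖ ^ 2) volume :=
    FluidPDE.integrable_sq_norm_of_lintegral_lt_top cΔ (lintegral_enorm_sq_lt_top_of_norm_le n_Δ l2Δ)
  have iΔg : Integrable (fun x => ⟪(Δ v) x, gradient q x⟫) volume :=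
    integrable_of_norm_le_mul_of_lintegral_sq (cΔ.inner cgq).aestronglyMeasurable c3D2 cgq
      l2Δ l2gq fun x => (norm_inner_le_norm _ _).trans
        (mul_le_mul_of_nonneg_right (n_Δ x) (norm_nonneg _))
  have iΔc : Integrable (fun x => ⟪(Δ v) x, FluidPDE.convect v v x⟫) volume :=
    integrable_of_norm_le_mul_of_lintegral_sq (cΔ.inner cconv).aestronglyMeasurable c3D2 cBDv
      l2Δ l2BDv fun x => (norm_inner_le_norm _ _).trans
        (mul_le_mul (n_Δ x) (n_conv x) (norm_nonneg _) (norm_nonneg _))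
  have ifrob : Integrable (fun x => FluidPDE.frobeniusNormSq (fderiv ℝ v x)) volume :=
    integrable_frobeniusNormSq_fderiv' hv1' hv1
  have idet : Integrable (fun x => LinearMap.det
      (fderiv ℝ v x : EuclideanSpace ℝ (Fin 3) →ₗ[ℝ] EuclideanSpace ℝ (Fin 3))) volume :=
    integrable_det_fderiv' hv1' hB₁ hv1
  -- the per-component real quantities
  have i_a : ∀ j, Integrable (fun x => ‖fderiv ℝ v x (e j)‖ ^ 2) volume := fun j =>
    FluidPDE.integrable_sq_norm_of_lintegral_lt_top (cdiv j) (l2div j)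
  have i_φa : ∀ j, Integrable (fun x => φ x * ‖fderiv ℝ v x (e j)‖ ^ 2) volume := by
    intro j
    have hdom : Integrable (fun x => B₁ * ‖fderiv ℝ v x (e j)‖ ^ 2) volume := (i_a j).const_mul _
    refine hdom.mono' (hφc.mul ((cdiv j).norm.pow 2)).aestronglyMeasurable
      (Eventually.of_forall fun x => ?_)
    rw [Real.norm_of_nonneg (mul_nonneg (hφ0 x) (sq_nonneg _))]
    exact mul_le_mul_of_nonneg_right (hφB x) (sq_nonneg _)
  have i_φF : Integrable (fun x => 2 * φ x * FluidPDE.frobeniusNormSq (fderiv ℝ v x)) volume := by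
    have hdom : Integrable (fun x => (2 * B₁) * FluidPDE.frobeniusNormSq (fderiv ℝ v x)) volume :=
      ifrob.const_mul _
    refine hdom.mono' ((continuous_const.mul hφc).mul
      (FluidPDE.continuous_frobeniusNormSq_fderiv hv1' (by simp))).aestronglyMeasurable
      (Eventually.of_forall fun x => ?_)
    have hF0 : 0 ≤ FluidPDE.frobeniusNormSq (fderiv ℝ v x) := FluidPDE.frobeniusNormSq_nonneg _
    rw [Real.norm_of_nonneg (by positivity)]
    have := hφB x
    nlinarith
  have i_Tj : ∀ j, Integrable (fun x => ⟪fderiv ℝ v x (e j), fderiv ℝ v x (fderiv ℝ v x (e j))⟫)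
      volume := by
    intro j
    have hdom : Integrable (fun x => B₁ * ‖fderiv ℝ v x (e j)‖ ^ 2) volume := (i_a j).const_mul _
    refine hdom.mono' ((cdiv j).inner (cDv.clm_apply (cdiv j))).aestronglyMeasurable
      (Eventually.of_forall fun x => ?_)
    calc ‖⟪fderiv ℝ v x (e j), fderiv ℝ v x (fderiv ℝ v x (e j))⟫‖
        ≤ ‖fderiv ℝ v x (e j)‖ * ‖fderiv ℝ v x (fderiv ℝ v x (e j))‖ := norm_inner_le_norm _ _
      _ ≤ ‖fderiv ℝ v x (e j)‖ * (B₁ * ‖fderiv ℝ v x (e j)‖) :=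
          mul_le_mul_of_nonneg_left ((fderiv ℝ v x).le_of_opNorm_le (hB₁ x) _) (norm_nonneg _)
      _ = B₁ * ‖fderiv ℝ v x (e j)‖ ^ 2 := by ring
  set a : Fin 3 → ℝ := fun j => ∫ x, ‖fderiv ℝ v x (e j)‖ ^ 2 with ha
  set P : Fin 3 → ℝ := fun j => 2 * ∫ x, φ x * ‖fderiv ℝ v x (e j)‖ ^ 2 with hP
  have ha0 : ∀ j, 0 ≤ a j := fun j => integral_nonneg fun x => sq_nonneg _
  -- `Σⱼ aⱼ = ∫ |∇v|²_F`, `Σⱼ Pⱼ = ∫ 2 φ |∇v|²_F`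
  have hsum_a : ∑ j, a j = ∫ x, FluidPDE.frobeniusNormSq (fderiv ℝ v x) := by
    rw [ha, ← integral_finsetSum _ fun j _ => i_a j]
    refine integral_congr_ae (Eventually.of_forall fun x => ?_)
    simp only
    rw [FluidPDE.frobeniusNormSq_eq_sum e]
  have hsum_P : ∑ j, P j = ∫ x, 2 * φ x * FluidPDE.frobeniusNormSq (fderiv ℝ v x) := by
    rw [hP]
    simp only
    rw [← Finset.mul_sum, ← integral_finsetSum _ fun j _ => i_φa j, ← integral_const_mul]
    refine integral_congr_ae (Eventually.of_forall fun x => ?_)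
    simp only
    rw [FluidPDE.frobeniusNormSq_eq_sum e, Finset.mul_sum, Finset.mul_sum]
    refine Finset.sum_congr rfl fun j _ => ?_
    ring
  -- Step 1: `∫ Σᵢ ⟪∂ᵢv, ∂ᵢW⟫ = -∫ ⟪Δv, W⟫`
  have hL := integral_sum_inner_fderiv_fderiv_eq_neg_integral_inner_laplacian hv2' hW i1 i2 i3
  -- Step 2: the pressure term vanishes
  have hpress : ∫ x, ⟪(Δ v) x, gradient q x⟫ = 0 := by
    have hswap : (fun x => ⟪(Δ v) x, gradient q x⟫) = fun x => ⟪gradient q x, (Δ v) x⟫ :=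
      funext fun x => real_inner_comm _ _
    rw [hswap]
    refine integral_inner_gradient_eq_zero_of_isDivFree_R3 hq hΔ1
      (isDivFree_laplacian_of_contDiff_three hv3' hdiv) (fun i => ?_) (fun i => ?_) (fun i => ?_)
    · refine integrable_of_norm_le_mul_of_lintegral_sq
        ((continuous_const.inner cΔ).mul (cdiq i)).aestronglyMeasurable c3D2 (cdiq i) l2Δ (l2diq i)
        fun x => ?_
      rw [norm_mul]
      exact mul_le_mul ((hin i _).trans (n_Δ x)) le_rfl (norm_nonneg _) (norm_nonneg _)
    · refine integrable_of_norm_le_mul_of_lintegral_sq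
        ((continuous_const.inner (cdΔ i)).mul cq).aestronglyMeasurable c3D3 cq l2dΔ hq0
        fun x => ?_
      rw [norm_mul]
      exact mul_le_mul ((hin i _).trans (n_dΔ i x)) le_rfl (norm_nonneg _) (norm_nonneg _)
    · refine integrable_of_norm_le_mul_of_lintegral_sq
        ((continuous_const.inner cΔ).mul cq).aestronglyMeasurable c3D2 cq l2Δ hq0
        fun x => ?_
      rw [norm_mul]
      exact mul_le_mul ((hin i _).trans (n_Δ x)) le_rfl (norm_nonneg _) (norm_nonneg _)
  -- Step 3: the pointwise identity `-⟪Δv, W⟫ = -ν‖Δv‖² + ⟪Δv, (v·∇)v⟫ + ⟪Δv, ∇q⟫`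
  have hpt : ∀ x, -⟪(Δ v) x, W x⟫ =
      -ν * ‖(Δ v) x‖ ^ 2 + ⟪(Δ v) x, FluidPDE.convect v v x⟫ + ⟪(Δ v) x, gradient q x⟫ := by
    intro x
    have hWx : W x = ν • (Δ v) x - FluidPDE.convect v v x - gradient q x := by
      have h : W x = ν • (Δ v) x - gradient q x - FluidPDE.convect v v x :=
        eq_sub_iff_add_eq.2 (hmom x)
      rw [h]; abel
    rw [hWx, inner_sub_right, inner_sub_right, inner_smul_right, real_inner_self_eq_norm_sq]
    ring
  -- Step 4: integrate
  have iA : Integrable (fun x => -ν * ‖(Δ v) x‖ ^ 2) volume := iΔΔ.const_mul _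
  have iAB : Integrable (fun x => -ν * ‖(Δ v) x‖ ^ 2 + ⟪(Δ v) x, FluidPDE.convect v v x⟫) volume :=
    iA.add iΔc
  have hint : ∫ x, -⟪(Δ v) x, W x⟫ =
      -ν * (∫ x, ‖(Δ v) x‖ ^ 2) + (∫ x, ⟪(Δ v) x, FluidPDE.convect v v x⟫) +
        ∫ x, ⟪(Δ v) x, gradient q x⟫ := by
    rw [integral_congr_ae (Eventually.of_forall hpt), integral_add iAB iΔg, integral_add iA iΔc,
      integral_const_mul]
  have hneg_int : ∫ x, -⟪(Δ v) x, W x⟫ = - ∫ x, ⟪(Δ v) x, W x⟫ := integral_neg _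
  -- Step 5: the trilinear term, bounded by the middle principal strain (Miller's Lemma 5.1)
  have htri : ∫ x, ⟪(Δ v) x, FluidPDE.convect v v x⟫ ≤ ∑ j, P j := by
    rw [integral_inner_laplacian_convect_eq_neg_sum hv3' hdiv hB hB₁ hv1 hv2,
      ← integral_finsetSum _ fun j _ => i_Tj j, ← integral_neg, hsum_P]
    have hdet0 := integral_det_fderiv_eq_zero hv hB hB₁ hv1
    have hup : ∫ x, 2 * φ x * FluidPDE.frobeniusNormSq (fderiv ℝ v x) =
        ∫ x, (2 * φ x * FluidPDE.frobeniusNormSq (fderiv ℝ v x) +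
          LinearMap.det (fderiv ℝ v x : EuclideanSpace ℝ (Fin 3) →ₗ[ℝ] EuclideanSpace ℝ (Fin 3))) := by
      rw [integral_add i_φF idet, hdet0, add_zero]
    rw [hup]
    refine integral_mono (integrable_finsetSum _ fun j _ => i_Tj j).neg (i_φF.add idet) fun x => ?_
    simp only
    have h := neg_sum_inner_apply_apply_le_midStrain (fderiv ℝ v x) (hdiv x)
    simpa only [hφdef, mul_assoc] using h
  -- Step 6: the sup bound on `Σⱼ Pⱼ = ∫ 2 φ |∇v|²_F ≤ 2 M₀ ∫ |∇v|²_F`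
  have hkey : ∑ j, P j ≤ 2 * M₀ * ∫ x, FluidPDE.frobeniusNormSq (fderiv ℝ v x) := by
    rw [hsum_P, ← integral_const_mul]
    refine integral_mono i_φF (ifrob.const_mul _) fun x => ?_
    have hF0 : 0 ≤ FluidPDE.frobeniusNormSq (fderiv ℝ v x) := FluidPDE.frobeniusNormSq_nonneg _
    simp only
    nlinarith [hφm x, hφ0 x]
  -- Step 7: conclude
  rw [hL, ← hneg_int, hint, hpress, add_zero]
  linarith [htri, hkey]


end Literature.Analysis.FluidPDE

end
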